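import Summits.MatrixMultiplication.MatrixMultiplication.Theorems.SaturationLadderTwinExact
import Summits.MatrixMultiplication.MatrixMultiplication.Theorems.SaturationLadderTwinReduction
import HarnessLib

/-!
# SaturationLadder — the twin rung from ONE parametric family: two entropy inequalities remain

Route `SaturationLadder` (sub-problem `MatrixMultiplication`), aside `TwinSaturation`
(stmt-MatrixMultiplication-30539).  This file fixes the STAGE-2 family of output-perfect six-letter
types of the twin tensor `TW_{2^j}` (cell `decomp-mm`, lens 1, gen 8,
`gen8/twin-family-tables-g8.txt`):
in units of `1/d`, `d = 2^{j+1} + 3`, the masses are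
`U = 3/2 + 1/j` on `(1,1,0)`, `W' = U + 17/(20 j)` on `(1,0,1)`, `2^{j+1} − W'` on `(0,1,1)`,
`V' = 1/2 − 1/j` on `(0,2,0)`, `0` on `(2,0,0)`, `1` on `(0,0,2)`; clearing denominators (`× 20 j`):

  `n₁ = 30 j + 20`, `n₂ = 20 j · 2^{j+1} − (30 j + 37)`, `n₃ = 30 j + 37`, `n₄ = 10 j − 20`,
  `n₅ = 0`, `n₆ = 20 j`  (`fN₁ … fN₆`),

with abscissa `t_j = j n₁ / ((j+1) n₃) = j (30j+20) / ((j+1)(30j+37)) → 1` (`fT`) and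
ordinate `r_j = ((j+1) n₂ + n₁ + n₄) / ((j+1) n₃) ≤ 2^{j+1}` (`fR`).

**`twinSaturation_of_family`**: IF for every `j ≥ 64` the `X`- and `Y`-marginal laws of this type
have at least the entropy of its `Z`-marginal law (the two hypotheses, literally the `hX`, `hY` of
`omegaRect_one_tw_exact`), THEN `TwinSaturation`.  Proof: each member is an exact certificate
`ω(1, t_j, r_j) ≤ 1 + r_j` (`omegaRect_one_tw_exact`); `1 − t_j ≤ 2/j` exhausts `[0,1)`;
`r_{j+1} ≤ 2^{j+2} ≤ r_64 · 3^{1/(1−t_j)}` because `1/(1−t_j) ≥ (30j+37)/47` and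
`3^{30} ≥ 2^{47}`; then `twinSaturation_of_certificates` with `C = r_64`.

What remains for the rung is therefore exactly the pair of real inequalities `hX`, `hY` along this
family (numerically: slack · d · log 2 → 0.066 resp. 0.031 − 1.80/j, positive from j ≈ 58;
tables in the cell).  No named facts, no sorry; the seven small `def`s are the family's counts and
coordinates.
-/

set_option linter.dupNamespace false
-- (single-conjunct summit: the namespace repeats `MatrixMultiplication`)

noncomputable section

namespace Summit.MatrixMultiplication.MatrixMultiplication.Theorems.SaturationLadderTwinFamily

open Literature.Computability.AlgebraicComplexity
open Summit.MatrixMultiplication.MatrixMultiplication.Theses.SaturationLadder (TwinSaturation)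
open Summit.MatrixMultiplication.MatrixMultiplication.Theorems.SaturationLadderTwinExact
  (omegaRect_one_tw_exact)
open Summit.MatrixMultiplication.MatrixMultiplication.Theorems.SaturationLadderTwinReduction
  (twinSaturation_of_certificates)

/-! ## The family -/

/-- count of `(1,1,0)`: `30 j + 20`. [folklore] -/
def fN₁ (j : ℕ) : ℕ := 30 * j + 20
/-- count of `(0,1,1)`: `20 j · 2^{j+1} − (30 j + 37)`. [folklore] -/
def fN₂ (j : ℕ) : ℕ := 20 * j * 2 ^ (j + 1) - (30 * j + 37)
/-- count of `(1,0,1)`: `30 j + 37`. [folklore] -/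
def fN₃ (j : ℕ) : ℕ := 30 * j + 37
/-- count of `(0,2,0)`: `10 j − 20`. [folklore] -/
def fN₄ (j : ℕ) : ℕ := 10 * j - 20
/-- count of `(0,0,2)`: `20 j`. [folklore] -/
def fN₆ (j : ℕ) : ℕ := 20 * j

/-- abscissa `t_j = j n₁ / ((j+1) n₃ + n₅)` (the shape of `omegaRect_one_tw_exact`).
[folklore] -/
def fT (j : ℕ) : ℝ :=
  ((j : ℝ) * (fN₁ j : ℕ)) / (((j : ℝ) + 1) * (fN₃ j : ℕ) + ((0 : ℕ) : ℝ))
/-- ordinate `r_j = ((j+1) n₂ + n₁ + n₄) / ((j+1) n₃ + n₅)`. [folklore] -/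
def fR (j : ℕ) : ℝ :=
  (((j : ℝ) + 1) * (fN₂ j : ℕ) + (fN₁ j : ℕ) + (fN₄ j : ℕ)) /
    (((j : ℝ) + 1) * (fN₃ j : ℕ) + ((0 : ℕ) : ℝ))

/-! ## Arithmetic of the family -/

/-- `30 j + 37 ≤ 20 j · 2^{j+1}` (`j ≥ 1`): the subtraction in `fN₂` does not truncate. [folklore] -/
theorem le_fN₂_aux (j : ℕ) (hj : 1 ≤ j) : 30 * j + 37 ≤ 20 * j * 2 ^ (j + 1) := by
  have h4 : 4 ≤ 2 ^ (j + 1) := by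
    calc 4 = 2 ^ 2 := by norm_num
      _ ≤ 2 ^ (j + 1) := Nat.pow_le_pow_right (by norm_num) (by omega)
  calc 30 * j + 37 ≤ 20 * j * 4 := by omega
    _ ≤ 20 * j * 2 ^ (j + 1) := Nat.mul_le_mul_left _ h4

/-- output-perfect, second condition: `n₂ + n₃ = 2^{j+1} n₆`. [folklore] -/
theorem fN₂_add_fN₃ (j : ℕ) (hj : 1 ≤ j) : fN₂ j + fN₃ j = 2 ^ (j + 1) * fN₆ j := by
  unfold fN₂ fN₃ fN₆
  rw [Nat.sub_add_cancel (le_fN₂_aux j hj)]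
  ring

/-- output-perfect, first condition: `n₁ + n₄ + n₅ = 2 n₆` (`j ≥ 2`). [folklore] -/
theorem fN₁_add_fN₄ (j : ℕ) (hj : 2 ≤ j) : fN₁ j + fN₄ j + 0 = 2 * fN₆ j := by
  unfold fN₁ fN₄ fN₆; omega

/-- `n₂` as a real number. [folklore] -/
theorem fN₂_cast (j : ℕ) (hj : 1 ≤ j) :
    ((fN₂ j : ℕ) : ℝ) = 20 * (j : ℝ) * (2 : ℝ) ^ (j + 1) - (30 * (j : ℝ) + 37) := by
  unfold fN₂
  rw [Nat.cast_sub (le_fN₂_aux j hj)]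
  push_cast; ring

/-- `n₄` as a real number (`j ≥ 2`). [folklore] -/
theorem fN₄_cast (j : ℕ) (hj : 2 ≤ j) : ((fN₄ j : ℕ) : ℝ) = 10 * (j : ℝ) - 20 := by
  unfold fN₄
  rw [Nat.cast_sub (by omega)]
  push_cast; ring

/-- `t_j = j (30j+20) / ((j+1)(30j+37))`. [folklore] -/
theorem fT_eq (j : ℕ) :
    fT j = ((j : ℝ) * (30 * j + 20)) / (((j : ℝ) + 1) * (30 * j + 37)) := by
  unfold fT fN₁ fN₃; push_cast; ring_nf

/-- `1 − t_j = (47 j + 37) / ((j+1)(30j+37))`. [folklore] -/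
theorem one_sub_fT (j : ℕ) :
    1 - fT j = (47 * (j : ℝ) + 37) / (((j : ℝ) + 1) * (30 * j + 37)) := by
  rw [fT_eq]
  have h : (0 : ℝ) < ((j : ℝ) + 1) * (30 * j + 37) := by positivity
  field_simp
  ring

/-- `t_j ≥ 1 − 2/j` (`j ≥ 1`). [folklore] -/
theorem one_sub_fT_le (j : ℕ) (hj : 1 ≤ j) : 1 - fT j ≤ 2 / (j : ℝ) := by
  rw [one_sub_fT]
  have hj' : (1 : ℝ) ≤ j := by exact_mod_cast hj
  rw [div_le_div_iff₀ (by positivity) (by positivity)]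
  nlinarith [sq_nonneg (j : ℝ)]

/-- `t_j < 1`. [folklore] -/
theorem fT_lt_one (j : ℕ) : fT j < 1 := by
  have h := one_sub_fT j
  have : 0 < (47 * (j : ℝ) + 37) / (((j : ℝ) + 1) * (30 * j + 37)) := by positivity
  linarith

/-- `r_j` in closed form (`j ≥ 2`). [folklore] -/
theorem fR_eq (j : ℕ) (hj : 2 ≤ j) :
    fR j = (((j : ℝ) + 1) * (20 * (j : ℝ) * (2 : ℝ) ^ (j + 1) - (30 * (j : ℝ) + 37)) + 40 * j) /
      (((j : ℝ) + 1) * (30 * j + 37)) := by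
  unfold fR
  rw [fN₂_cast j (by omega), fN₄_cast j hj]
  unfold fN₁ fN₃; push_cast; ring_nf

/-- `4 ≤ r_j` (`j ≥ 3`). [folklore] -/
theorem four_le_fR (j : ℕ) (hj : 3 ≤ j) : 4 ≤ fR j := by
  rw [fR_eq j (by omega), le_div_iff₀ (by positivity)]
  have hj' : (3 : ℝ) ≤ j := by exact_mod_cast hj
  have h16 : (16 : ℝ) ≤ (2 : ℝ) ^ (j + 1) := by
    calc (16 : ℝ) = 2 ^ 4 := by norm_num
      _ ≤ 2 ^ (j + 1) := pow_le_pow_right₀ (by norm_num) (by omega)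
  have hprod := mul_le_mul_of_nonneg_left h16 (by positivity : (0 : ℝ) ≤ ((j : ℝ) + 1) * j)
  have e : ((j : ℝ) + 1) * (20 * (j : ℝ) * (2 : ℝ) ^ (j + 1) - (30 * (j : ℝ) + 37)) + 40 * j =
      20 * (((j : ℝ) + 1) * j * (2 : ℝ) ^ (j + 1)) - ((j : ℝ) + 1) * (30 * j + 37) + 40 * j := by
    ring
  rw [e]
  nlinarith

/-- `1 ≤ r_j` (`j ≥ 3`). [folklore] -/
theorem one_le_fR (j : ℕ) (hj : 3 ≤ j) : 1 ≤ fR j :=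
  (by norm_num : (1 : ℝ) ≤ 4).trans (four_le_fR j hj)

/-- `r_j ≤ 2^{j+1}` (`j ≥ 2`). [folklore] -/
theorem fR_le (j : ℕ) (hj : 2 ≤ j) : fR j ≤ (2 : ℝ) ^ (j + 1) := by
  rw [fR_eq j hj, div_le_iff₀ (by positivity)]
  have hj' : (2 : ℝ) ≤ j := by exact_mod_cast hj
  have h1 : (1 : ℝ) ≤ (2 : ℝ) ^ (j + 1) := one_le_pow₀ (by norm_num)
  have hprod := mul_le_mul_of_nonneg_left h1
    (by positivity : (0 : ℝ) ≤ ((j : ℝ) + 1) * (10 * j + 37))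
  have e : (2 : ℝ) ^ (j + 1) * (((j : ℝ) + 1) * (30 * j + 37)) =
      20 * (((j : ℝ) + 1) * j * (2 : ℝ) ^ (j + 1)) +
        ((j : ℝ) + 1) * (10 * j + 37) * (2 : ℝ) ^ (j + 1) := by ring
  have e' : ((j : ℝ) + 1) * (20 * (j : ℝ) * (2 : ℝ) ^ (j + 1) - (30 * (j : ℝ) + 37)) + 40 * j =
      20 * (((j : ℝ) + 1) * j * (2 : ℝ) ^ (j + 1)) - ((j : ℝ) + 1) * (30 * j + 37) + 40 * j := by
    ring
  rw [e, e']
  nlinarith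

/-- `2^j ≤ 3^{1/(1 − t_j)}`: `1/(1−t_j) ≥ (30j+37)/47 ≥ 30j/47` and `3^{30} ≥ 2^{47}`. [folklore] -/
theorem two_pow_le_three_rpow (j : ℕ) : (2 : ℝ) ^ j ≤ (3 : ℝ) ^ (1 / (1 - fT j)) := by
  -- exponent comparison
  have hexp : (30 : ℝ) * j / 47 ≤ 1 / (1 - fT j) := by
    rw [one_sub_fT, one_div_div]
    rw [div_le_div_iff₀ (by norm_num) (by positivity)]
    nlinarith [sq_nonneg (j : ℝ), (Nat.cast_nonneg j : (0 : ℝ) ≤ j)]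
  refine le_trans ?_ (Real.rpow_le_rpow_of_exponent_le (by norm_num : (1 : ℝ) ≤ 3) hexp)
  -- `2^j = (2^47)^{j/47} ≤ (3^30)^{j/47} = 3^{30 j / 47}`
  have h47 : ((2 : ℝ) ^ (47 : ℕ)) ≤ (3 : ℝ) ^ (30 : ℕ) := by norm_num
  have hj0 : (0 : ℝ) ≤ (j : ℝ) / 47 := by positivity
  have e2 : (2 : ℝ) ^ j = ((2 : ℝ) ^ (47 : ℕ)) ^ ((j : ℝ) / 47) := by
    rw [← Real.rpow_natCast (2 : ℝ) 47, ← Real.rpow_mul (by norm_num : (0 : ℝ) ≤ 2),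
      ← Real.rpow_natCast (2 : ℝ) j]
    congr 1; push_cast; ring
  have e3 : (3 : ℝ) ^ ((30 : ℝ) * j / 47) = ((3 : ℝ) ^ (30 : ℕ)) ^ ((j : ℝ) / 47) := by
    rw [← Real.rpow_natCast (3 : ℝ) 30, ← Real.rpow_mul (by norm_num : (0 : ℝ) ≤ 3)]
    congr 1; push_cast; ring
  rw [e2, e3]
  exact Real.rpow_le_rpow (by positivity) h47 hj0

/-! ## The conditional rung -/

/-- **`TwinSaturation` from the STAGE-2 family**, conditional on the two entropy inequalities
`H(Z_j) ≤ H(X_j)` and `H(Z_j) ≤ H(Y_j)` for all `j ≥ 64` (literally the hypotheses `hX`, `hY` of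
`omegaRect_one_tw_exact` at `(n₁,…,n₆) = (fN₁ j, fN₂ j, fN₃ j, fN₄ j, 0, fN₆ j)`).
[cite: AlmanDuanVassilevskaWilliamsXuXuZhou2025, Thm. 3.2, §3.4] [cite: CoppersmithWinograd1990, §8] -/
theorem twinSaturation_of_family
    (hX : ∀ j : ℕ, 64 ≤ j →
      shannonEntropy
          ![((fN₁ j : ℝ) + fN₄ j + (0 : ℕ)) / (fN₁ j + fN₂ j + fN₃ j + fN₄ j + 0 + fN₆ j : ℕ),
          ((fN₂ j : ℝ) + fN₃ j) / (fN₁ j + fN₂ j + fN₃ j + fN₄ j + 0 + fN₆ j : ℕ),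
          (fN₆ j : ℝ) / (fN₁ j + fN₂ j + fN₃ j + fN₄ j + 0 + fN₆ j : ℕ)] ≤
        shannonEntropy
          ![((fN₂ j : ℝ) + fN₄ j + fN₆ j) / (fN₁ j + fN₂ j + fN₃ j + fN₄ j + 0 + fN₆ j : ℕ),
          ((fN₁ j : ℝ) + fN₃ j) / (fN₁ j + fN₂ j + fN₃ j + fN₄ j + 0 + fN₆ j : ℕ),
          ((0 : ℕ) : ℝ) / (fN₁ j + fN₂ j + fN₃ j + fN₄ j + 0 + fN₆ j : ℕ)])
    (hY : ∀ j : ℕ, 64 ≤ j →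
      shannonEntropy
          ![((fN₁ j : ℝ) + fN₄ j + (0 : ℕ)) / (fN₁ j + fN₂ j + fN₃ j + fN₄ j + 0 + fN₆ j : ℕ),
          ((fN₂ j : ℝ) + fN₃ j) / (fN₁ j + fN₂ j + fN₃ j + fN₄ j + 0 + fN₆ j : ℕ),
          (fN₆ j : ℝ) / (fN₁ j + fN₂ j + fN₃ j + fN₄ j + 0 + fN₆ j : ℕ)] ≤
        shannonEntropy
          ![((fN₃ j : ℝ) + (0 : ℕ) + fN₆ j) / (fN₁ j + fN₂ j + fN₃ j + fN₄ j + 0 + fN₆ j : ℕ),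
          ((fN₁ j : ℝ) + fN₂ j) / (fN₁ j + fN₂ j + fN₃ j + fN₄ j + 0 + fN₆ j : ℕ),
          (fN₄ j : ℝ) / (fN₁ j + fN₂ j + fN₃ j + fN₄ j + 0 + fN₆ j : ℕ)]) :
    TwinSaturation := by
  refine twinSaturation_of_certificates (fR 64) (fun k => fT (64 + k)) (fun k => fR (64 + k))
    (fun k => one_le_fR (64 + k) (by omega)) (fun k => ?_) (fun s hs => ?_) ?_ (fun k => ?_)
  · -- each member is an exact certificate
    exact omegaRect_one_tw_exact (64 + k) (fN₁ (64 + k)) (fN₂ (64 + k)) (fN₃ (64 + k))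
      (fN₄ (64 + k)) 0 (fN₆ (64 + k)) (by unfold fN₆; omega) (fN₁_add_fN₄ (64 + k) (by omega))
      (fN₂_add_fN₃ (64 + k) (by omega)) (by unfold fN₃; positivity) (hX (64 + k) (by omega))
      (hY (64 + k) (by omega))
  · -- the abscissae exhaust `[0,1)`: `1 − t_j ≤ 2/j`
    obtain ⟨k, hk⟩ := exists_nat_ge (2 / (1 - s))
    refine ⟨k, ?_⟩
    have h1s : 0 < 1 - s := by linarith
    have hjpos : (0 : ℝ) < ((64 + k : ℕ) : ℝ) := by positivity
    have hle := one_sub_fT_le (64 + k) (by omega)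
    -- `2/(64+k) ≤ 1 − s`
    have hk' : 2 / (1 - s) ≤ ((64 + k : ℕ) : ℝ) := hk.trans (by push_cast; linarith)
    have h2 : 2 / ((64 + k : ℕ) : ℝ) ≤ 1 - s := by
      rw [div_le_iff₀ hjpos]
      have := (div_le_iff₀ h1s).1 hk'
      linarith
    show s ≤ fT (64 + k)
    linarith
  · -- `r_64 ≤ 3 r_64`
    show fR (64 + 0) ≤ 3 * fR 64
    norm_num
    linarith [one_le_fR 64 (by norm_num)]
  · -- growth: `r_{j+1} ≤ 2^{j+2} = 4 · 2^j ≤ r_64 · 3^{1/(1−t_j)}`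
    show fR (64 + (k + 1)) ≤ fR 64 * (3 : ℝ) ^ (1 / (1 - fT (64 + k)))
    have h1 := fR_le (64 + (k + 1)) (by omega)
    have h2 := two_pow_le_three_rpow (64 + k)
    have h3 := four_le_fR 64 (by norm_num)
    have e : (2 : ℝ) ^ (64 + (k + 1) + 1) = 4 * (2 : ℝ) ^ (64 + k) := by ring
    rw [e] at h1
    have h4 : (0 : ℝ) ≤ (2 : ℝ) ^ (64 + k) := by positivity
    nlinarith [mul_le_mul h3 h2 h4 (by linarith)]

end Summit.MatrixMultiplication.MatrixMultiplication.Theorems.SaturationLadderTwinFamily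

end
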